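import Literature.NumberTheory.EllipticCurves.BSDRootNumberSmallConductorProofs
import Summits.BirchSwinnertonDyer.Rank1Residual.LW16.DescentReRouteShape
import Summits.BirchSwinnertonDyer.Rank1Residual.X11b.KrausMinimalityGeneralTwo
import HarnessLib

/-!
# LW16 re-route — RECORDS (N5K): `BSD(E,p)` PER PAIR for the 11 RESIDUE register cells of conductor `< 5000`
# from the UMBRELLA print Miller 2011 Thm. 1.2 + Creutz–Miller 2012 Thm. 1.1 (tree named facts
# `bsdp_of_irreducible_of_conductor_lt`, `bsdp_of_reducible_of_conductor_lt`), displayed `hr`, `hN`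

HONEST FRAMING (programme BSD-LIT2PART v1 §T3; cell `pub/bsd-litref/lw16`; seat `bsd-litref-lw16-pv` g5): nothing here proves BSD; PER-PAIR
theorems (OFFERS — the desk books, nothing is booked here); referee A R973 (2026-08-27T22:18Z) policy word (β) = WANTED, tier of record
LITERAL with flag `N5K-umbrella-computational(Miller2011-Thm1.2+CM12-Thm1.1)`@p (never PROVED: the umbrella print does not name the curves); lead g8 GO 22:18:58Z. Each ROW is a RESIDUE open cell of referee A2's newest
state (scratchA2_state_after_irred_t1_onSsadd3_fold.pkl); the cm12 cells (1050o, 1950y, 2550be @5) are NOT here (their road is Creutz–Miller §7.1 per curve).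
Composition: `forall_bsdp_of_conductor_lt hirr hred` (file BSDRootNumberSmallConductorProofs) on the literal Cremona model with `Δ ≠ 0` and
global minimality KERNEL-DECIDED (`X11b.isElliptic_of_discOf_ne_zero`, `X11b.isGloballyMinimal_of_krausCriterion_support`), `hr` (Cremona rank,
displayed as in every lane record) and `hN : W.conductorNorm ℤ = N` (Cremona conductor; `conductorNorm` is noncomputable in the tree, so the
conductor is a READ datum like the rank). No image / descent / Heegner binder, and — unlike the Ш-currency records — NO `hGZK`/`hq`/`hv`
binders: the umbrella print asserts `BSD(E,p)` outright from `r_an ≤ 1 ∧ N < 5000`, so `#Ш_an` enters no hypothesis (it is carried in the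
cells table with a second `shaan_own` reading for the desk); an unused displayed binder would be a lint bounce, not extra honesty. The umbrella's own provenance (computer-assisted; reducible
`p ≥ 5` leaf through GJPST Thm. 3.5 as corrected by Lawson–Wuthrich 2016 §5) is documented in `BSDRootNumberSmallConductorIrreducibleProofs`.
Theorems only; no definition, no named fact, no `sorry`.
-/

set_option autoImplicit false

noncomputable section

open scoped Classical

open WeierstrassCurve Literature.NumberTheory.EllipticCurves
  Literature.NumberTheory.EllipticCurves.Rank1Residual.X11RankOneCertificates
open Summit.BirchSwinnertonDyer.Rank1Residual.X11b Summit.BirchSwinnertonDyer.Rank1Residual.LW16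

namespace Summit.BirchSwinnertonDyer.Rank1Residual.LW16

/-- **Record shape (umbrella small-conductor print).** On the literal model `[a₁,a₂,a₃,a₄,a₆]` with `Δ ≠ 0` (kernel-decided) and a
global-minimality certificate (`X11b.isGloballyMinimal_of_krausCriterion_support`), `BSD(E,p)` for EVERY prime `p` from the tree's two
named facts `bsdp_of_irreducible_of_conductor_lt` / `bsdp_of_reducible_of_conductor_lt` (Miller 2011 Thm. 1.2 + Creutz–Miller 2012,
assembled as `forall_bsdp_of_conductor_lt`), given the displayed analytic rank `r ≤ 1` (`hr`) and conductor `N < 5000` (`hN`, `hN5`).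
No image, descent or Heegner binder. [cite: Miller2011LMS, Thm. 1.2] [cite: CreutzMiller2012, Thm. 1.1] -/
theorem bsdp_of_ainvs_of_conductor_lt (hirr : bsdp_of_irreducible_of_conductor_lt)
    (hred : bsdp_of_reducible_of_conductor_lt) (a1 a2 a3 a4 a6 : ℤ) (p : ℕ) (hp : p.Prime)
    (hΔ : discOf [a1, a2, a3, a4, a6] ≠ 0)
    (hmin : (⟨a1, a2, a3, a4, a6⟩ : WeierstrassCurve ℚ).IsGloballyMinimal) {r N : ℕ}
    (hr : (⟨a1, a2, a3, a4, a6⟩ : WeierstrassCurve ℚ).analyticRank = r) (hr1 : r ≤ 1)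
    (hN : (⟨a1, a2, a3, a4, a6⟩ : WeierstrassCurve ℚ).conductorNorm ℤ = N) (hN5 : N < 5000) :
    BSDp (⟨a1, a2, a3, a4, a6⟩ : WeierstrassCurve ℚ) p := by
  haveI := isElliptic_of_discOf_ne_zero a1 a2 a3 a4 a6 hΔ
  haveI := hmin
  exact forall_bsdp_of_conductor_lt hirr hred _ (hr ▸ hr1) (hN ▸ hN5) p hp

/-- ROW `(3718h, 2)`: RESIDUE open cell `X5` — `3718h1` `[1,1,0,-76672599,-258441399211]` (curve 1), `N = 3718 = 2·11·13^2
< 5000`, multiplicative at `2`, `E[2]` irreducible (class word X5), `r = 0`, `#tors = 1`, `∏c = 4`, `#Ш_an = 16`. NO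
certificate line: `BSD(E,2)` is the UMBRELLA print (Miller 2011 Thm. 1.2 with Creutz–Miller 2012: every `E/ℚ` with `N
< 5000`, `r_an ≤ 1`, every prime) via the tree's named facts `hirr`/`hred`; displayed: `hr` (Cremona rank), `hN`
(conductor, Cremona); kernel-decided: `Δ ≠ 0` and global minimality (Kraus support `|Δ| = 2^10·11^2·13^10`).
[cite: Miller2011LMS, Thm. 1.2 and §7] [cite: CreutzMiller2012, Thm. 1.1] [cite: Cremona1997, Table 1 (Cremona label 3718h1)] -/
theorem bsdp2_n5k_3718h1 (hirr : bsdp_of_irreducible_of_conductor_lt)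
    (hred : bsdp_of_reducible_of_conductor_lt)
    (W : WeierstrassCurve ℚ) (hWm : W = ⟨1, 1, 0, -76672599, -258441399211⟩) (hr : W.analyticRank = 0)
    (hN : W.conductorNorm ℤ = 3718) : BSDp W 2 := by
  subst hWm
  exact bsdp_of_ainvs_of_conductor_lt hirr hred 1 1 0 (-76672599) (-258441399211) 2 (by norm_num) (by decide +kernel)
    (isGloballyMinimal_of_krausCriterion_support 1 1 0 (-76672599) (-258441399211)
      [(2, 1, 10), (11, 1, 2), (13, 2, 10)]
      (by intro t ht; simp only [List.mem_cons, List.not_mem_nil, or_false] at ht; rcases ht with rfl | rfl | rfl <;> norm_num)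
      (by decide +kernel) (by decide +kernel))
    hr (by norm_num) hN (by norm_num)

/-- ROW `(2400bc, 5)`: RESIDUE open cell `X4` — `2400bc1` `[0,1,0,-733,7403]` (curve 1), `N = 2400 = 2^5·3·5^2 < 5000`,
additive at `5`, `E[5]` irreducible (class word X4), `r = 1`, `#tors = 1`, `∏c = 10`, `#Ш_an = 1`. NO certificate
line: `BSD(E,5)` is the UMBRELLA print (Miller 2011 Thm. 1.2 with Creutz–Miller 2012: every `E/ℚ` with `N < 5000`,
`r_an ≤ 1`, every prime) via the tree's named facts `hirr`/`hred`; displayed: `hr` (Cremona rank), `hN` (conductor,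
Cremona); kernel-decided: `Δ ≠ 0` and global minimality (Kraus support `|Δ| = 2^12·3^5·5^2`).
[cite: Miller2011LMS, Thm. 1.2 and §7] [cite: CreutzMiller2012, Thm. 1.1] [cite: Cremona1997, Table 1 (Cremona label 2400bc1)] -/
theorem bsdp5_n5k_2400bc1 (hirr : bsdp_of_irreducible_of_conductor_lt)
    (hred : bsdp_of_reducible_of_conductor_lt)
    (W : WeierstrassCurve ℚ) (hWm : W = ⟨0, 1, 0, -733, 7403⟩) (hr : W.analyticRank = 1)
    (hN : W.conductorNorm ℤ = 2400) : BSDp W 5 := by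
  subst hWm
  exact bsdp_of_ainvs_of_conductor_lt hirr hred 0 1 0 (-733) 7403 5 (by norm_num) (by decide +kernel)
    (isGloballyMinimal_of_krausCriterion_support 0 1 0 (-733) 7403
      [(2, 5, 12), (3, 1, 5), (5, 2, 2)]
      (by intro t ht; simp only [List.mem_cons, List.not_mem_nil, or_false] at ht; rcases ht with rfl | rfl | rfl <;> norm_num)
      (by decide +kernel) (by decide +kernel))
    hr (by norm_num) hN (by norm_num)

/-- ROW `(2400bg, 5)`: RESIDUE open cell `X4` — `2400bg1` `[0,1,0,-18333,-962037]` (curve 1), `N = 2400 = 2^5·3·5^2 <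
5000`, additive at `5`, `E[5]` irreducible (class word X4), `r = 0`, `#tors = 1`, `∏c = 10`, `#Ш_an = 1`. NO
certificate line: `BSD(E,5)` is the UMBRELLA print (Miller 2011 Thm. 1.2 with Creutz–Miller 2012: every `E/ℚ` with `N
< 5000`, `r_an ≤ 1`, every prime) via the tree's named facts `hirr`/`hred`; displayed: `hr` (Cremona rank), `hN`
(conductor, Cremona); kernel-decided: `Δ ≠ 0` and global minimality (Kraus support `|Δ| = 2^12·3^5·5^8`).
[cite: Miller2011LMS, Thm. 1.2 and §7] [cite: CreutzMiller2012, Thm. 1.1] [cite: Cremona1997, Table 1 (Cremona label 2400bg1)] -/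
theorem bsdp5_n5k_2400bg1 (hirr : bsdp_of_irreducible_of_conductor_lt)
    (hred : bsdp_of_reducible_of_conductor_lt)
    (W : WeierstrassCurve ℚ) (hWm : W = ⟨0, 1, 0, -18333, -962037⟩) (hr : W.analyticRank = 0)
    (hN : W.conductorNorm ℤ = 2400) : BSDp W 5 := by
  subst hWm
  exact bsdp_of_ainvs_of_conductor_lt hirr hred 0 1 0 (-18333) (-962037) 5 (by norm_num) (by decide +kernel)
    (isGloballyMinimal_of_krausCriterion_support 0 1 0 (-18333) (-962037)
      [(2, 5, 12), (3, 1, 5), (5, 2, 8)]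
      (by intro t ht; simp only [List.mem_cons, List.not_mem_nil, or_false] at ht; rcases ht with rfl | rfl | rfl <;> norm_num)
      (by decide +kernel) (by decide +kernel))
    hr (by norm_num) hN (by norm_num)

/-- ROW `(2760k, 5)`: RESIDUE open cell `X11b` — `2760k1` `[0,1,0,7615,1127283]` (curve 1), `N = 2760 = 2^3·3·5·23 <
5000`, multiplicative at `5`, `E[5]` irreducible (class word X11b), `r = 1`, `#tors = 1`, `∏c = 300`, `#Ш_an = 1`. NO
certificate line: `BSD(E,5)` is the UMBRELLA print (Miller 2011 Thm. 1.2 with Creutz–Miller 2012: every `E/ℚ` with `N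
< 5000`, `r_an ≤ 1`, every prime) via the tree's named facts `hirr`/`hred`; displayed: `hr` (Cremona rank), `hN`
(conductor, Cremona); kernel-decided: `Δ ≠ 0` and global minimality (Kraus support `|Δ| = 2^8·3^10·5^5·23^3`).
[cite: Miller2011LMS, Thm. 1.2 and §7] [cite: CreutzMiller2012, Thm. 1.1] [cite: Cremona1997, Table 1 (Cremona label 2760k1)] -/
theorem bsdp5_n5k_2760k1 (hirr : bsdp_of_irreducible_of_conductor_lt)
    (hred : bsdp_of_reducible_of_conductor_lt)
    (W : WeierstrassCurve ℚ) (hWm : W = ⟨0, 1, 0, 7615, 1127283⟩) (hr : W.analyticRank = 1)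
    (hN : W.conductorNorm ℤ = 2760) : BSDp W 5 := by
  subst hWm
  exact bsdp_of_ainvs_of_conductor_lt hirr hred 0 1 0 7615 1127283 5 (by norm_num) (by decide +kernel)
    (isGloballyMinimal_of_krausCriterion_support 0 1 0 7615 1127283
      [(2, 3, 8), (3, 1, 10), (5, 1, 5), (23, 1, 3)]
      (by intro t ht; simp only [List.mem_cons, List.not_mem_nil, or_false] at ht; rcases ht with rfl | rfl | rfl | rfl <;> norm_num)
      (by decide +kernel) (by decide +kernel))
    hr (by norm_num) hN (by norm_num)

/-- ROW `(3465d, 5)`: RESIDUE open cell `X11b` — `3465d1` `[1,-1,1,75868,4172014]` (curve 1), `N = 3465 = 3^2·5·7·11 <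
5000`, multiplicative at `5`, `E[5]` irreducible (class word X11b), `r = 1`, `#tors = 2`, `∏c = 100`, `#Ш_an = 1`. NO
certificate line: `BSD(E,5)` is the UMBRELLA print (Miller 2011 Thm. 1.2 with Creutz–Miller 2012: every `E/ℚ` with `N
< 5000`, `r_an ≤ 1`, every prime) via the tree's named facts `hirr`/`hred`; displayed: `hr` (Cremona rank), `hN`
(conductor, Cremona); kernel-decided: `Δ ≠ 0` and global minimality (Kraus support `|Δ| = 3^9·5^10·7^5·11^1`).
[cite: Miller2011LMS, Thm. 1.2 and §7] [cite: CreutzMiller2012, Thm. 1.1] [cite: Cremona1997, Table 1 (Cremona label 3465d1)] -/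
theorem bsdp5_n5k_3465d1 (hirr : bsdp_of_irreducible_of_conductor_lt)
    (hred : bsdp_of_reducible_of_conductor_lt)
    (W : WeierstrassCurve ℚ) (hWm : W = ⟨1, -1, 1, 75868, 4172014⟩) (hr : W.analyticRank = 1)
    (hN : W.conductorNorm ℤ = 3465) : BSDp W 5 := by
  subst hWm
  exact bsdp_of_ainvs_of_conductor_lt hirr hred 1 (-1) 1 75868 4172014 5 (by norm_num) (by decide +kernel)
    (isGloballyMinimal_of_krausCriterion_support 1 (-1) 1 75868 4172014
      [(3, 2, 9), (5, 1, 10), (7, 1, 5), (11, 1, 1)]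
      (by intro t ht; simp only [List.mem_cons, List.not_mem_nil, or_false] at ht; rcases ht with rfl | rfl | rfl | rfl <;> norm_num)
      (by decide +kernel) (by decide +kernel))
    hr (by norm_num) hN (by norm_num)

/-- ROW `(4230bg, 5)`: RESIDUE open cell `X11b` — `4230bg1` `[1,-1,1,11308,325559]` (curve 1), `N = 4230 = 2·3^2·5·47 <
5000`, multiplicative at `5`, `E[5]` irreducible (class word X11b), `r = 1`, `#tors = 2`, `∏c = 400`, `#Ш_an = 1`. NO
certificate line: `BSD(E,5)` is the UMBRELLA print (Miller 2011 Thm. 1.2 with Creutz–Miller 2012: every `E/ℚ` with `N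
< 5000`, `r_an ≤ 1`, every prime) via the tree's named facts `hirr`/`hred`; displayed: `hr` (Cremona rank), `hN`
(conductor, Cremona); kernel-decided: `Δ ≠ 0` and global minimality (Kraus support `|Δ| = 2^10·3^9·5^5·47^2`).
[cite: Miller2011LMS, Thm. 1.2 and §7] [cite: CreutzMiller2012, Thm. 1.1] [cite: Cremona1997, Table 1 (Cremona label 4230bg1)] -/
theorem bsdp5_n5k_4230bg1 (hirr : bsdp_of_irreducible_of_conductor_lt)
    (hred : bsdp_of_reducible_of_conductor_lt)
    (W : WeierstrassCurve ℚ) (hWm : W = ⟨1, -1, 1, 11308, 325559⟩) (hr : W.analyticRank = 1)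
    (hN : W.conductorNorm ℤ = 4230) : BSDp W 5 := by
  subst hWm
  exact bsdp_of_ainvs_of_conductor_lt hirr hred 1 (-1) 1 11308 325559 5 (by norm_num) (by decide +kernel)
    (isGloballyMinimal_of_krausCriterion_support 1 (-1) 1 11308 325559
      [(2, 1, 10), (3, 2, 9), (5, 1, 5), (47, 1, 2)]
      (by intro t ht; simp only [List.mem_cons, List.not_mem_nil, or_false] at ht; rcases ht with rfl | rfl | rfl | rfl <;> norm_num)
      (by decide +kernel) (by decide +kernel))
    hr (by norm_num) hN (by norm_num)

/-- ROW `(4590o, 5)`: RESIDUE open cell `X11b` — `4590o1` `[1,-1,1,-1877,429]` (curve 1), `N = 4590 = 2·3^3·5·17 < 5000`,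
multiplicative at `5`, `E[5]` irreducible (class word X11b), `r = 1`, `#tors = 1`, `∏c = 225`, `#Ш_an = 1`. NO
certificate line: `BSD(E,5)` is the UMBRELLA print (Miller 2011 Thm. 1.2 with Creutz–Miller 2012: every `E/ℚ` with `N
< 5000`, `r_an ≤ 1`, every prime) via the tree's named facts `hirr`/`hred`; displayed: `hr` (Cremona rank), `hN`
(conductor, Cremona); kernel-decided: `Δ ≠ 0` and global minimality (Kraus support `|Δ| = 2^15·3^5·5^5·17^1`).
[cite: Miller2011LMS, Thm. 1.2 and §7] [cite: CreutzMiller2012, Thm. 1.1] [cite: Cremona1997, Table 1 (Cremona label 4590o1)] -/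
theorem bsdp5_n5k_4590o1 (hirr : bsdp_of_irreducible_of_conductor_lt)
    (hred : bsdp_of_reducible_of_conductor_lt)
    (W : WeierstrassCurve ℚ) (hWm : W = ⟨1, -1, 1, -1877, 429⟩) (hr : W.analyticRank = 1)
    (hN : W.conductorNorm ℤ = 4590) : BSDp W 5 := by
  subst hWm
  exact bsdp_of_ainvs_of_conductor_lt hirr hred 1 (-1) 1 (-1877) 429 5 (by norm_num) (by decide +kernel)
    (isGloballyMinimal_of_krausCriterion_support 1 (-1) 1 (-1877) 429
      [(2, 1, 15), (3, 3, 5), (5, 1, 5), (17, 1, 1)]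
      (by intro t ht; simp only [List.mem_cons, List.not_mem_nil, or_false] at ht; rcases ht with rfl | rfl | rfl | rfl <;> norm_num)
      (by decide +kernel) (by decide +kernel))
    hr (by norm_num) hN (by norm_num)

/-- ROW `(4800be, 5)`: RESIDUE open cell `X4` — `4800be1` `[0,1,0,-4583,117963]` (curve 1), `N = 4800 = 2^6·3·5^2 < 5000`,
additive at `5`, `E[5]` irreducible (class word X4), `r = 1`, `#tors = 1`, `∏c = 15`, `#Ш_an = 1`. NO certificate
line: `BSD(E,5)` is the UMBRELLA print (Miller 2011 Thm. 1.2 with Creutz–Miller 2012: every `E/ℚ` with `N < 5000`,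
`r_an ≤ 1`, every prime) via the tree's named facts `hirr`/`hred`; displayed: `hr` (Cremona rank), `hN` (conductor,
Cremona); kernel-decided: `Δ ≠ 0` and global minimality (Kraus support `|Δ| = 2^6·3^5·5^8`).
[cite: Miller2011LMS, Thm. 1.2 and §7] [cite: CreutzMiller2012, Thm. 1.1] [cite: Cremona1997, Table 1 (Cremona label 4800be1)] -/
theorem bsdp5_n5k_4800be1 (hirr : bsdp_of_irreducible_of_conductor_lt)
    (hred : bsdp_of_reducible_of_conductor_lt)
    (W : WeierstrassCurve ℚ) (hWm : W = ⟨0, 1, 0, -4583, 117963⟩) (hr : W.analyticRank = 1)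
    (hN : W.conductorNorm ℤ = 4800) : BSDp W 5 := by
  subst hWm
  exact bsdp_of_ainvs_of_conductor_lt hirr hred 0 1 0 (-4583) 117963 5 (by norm_num) (by decide +kernel)
    (isGloballyMinimal_of_krausCriterion_support 0 1 0 (-4583) 117963
      [(2, 6, 6), (3, 1, 5), (5, 2, 8)]
      (by intro t ht; simp only [List.mem_cons, List.not_mem_nil, or_false] at ht; rcases ht with rfl | rfl | rfl <;> norm_num)
      (by decide +kernel) (by decide +kernel))
    hr (by norm_num) hN (by norm_num)

/-- ROW `(4800u, 5)`: RESIDUE open cell `X4` — `4800u1` `[0,1,0,-183,-1017]` (curve 1), `N = 4800 = 2^6·3·5^2 < 5000`,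
additive at `5`, `E[5]` irreducible (class word X4), `r = 0`, `#tors = 1`, `∏c = 5`, `#Ш_an = 1`. NO certificate line:
`BSD(E,5)` is the UMBRELLA print (Miller 2011 Thm. 1.2 with Creutz–Miller 2012: every `E/ℚ` with `N < 5000`, `r_an ≤
1`, every prime) via the tree's named facts `hirr`/`hred`; displayed: `hr` (Cremona rank), `hN` (conductor, Cremona);
kernel-decided: `Δ ≠ 0` and global minimality (Kraus support `|Δ| = 2^6·3^5·5^2`).
[cite: Miller2011LMS, Thm. 1.2 and §7] [cite: CreutzMiller2012, Thm. 1.1] [cite: Cremona1997, Table 1 (Cremona label 4800u1)] -/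
theorem bsdp5_n5k_4800u1 (hirr : bsdp_of_irreducible_of_conductor_lt)
    (hred : bsdp_of_reducible_of_conductor_lt)
    (W : WeierstrassCurve ℚ) (hWm : W = ⟨0, 1, 0, -183, -1017⟩) (hr : W.analyticRank = 0)
    (hN : W.conductorNorm ℤ = 4800) : BSDp W 5 := by
  subst hWm
  exact bsdp_of_ainvs_of_conductor_lt hirr hred 0 1 0 (-183) (-1017) 5 (by norm_num) (by decide +kernel)
    (isGloballyMinimal_of_krausCriterion_support 0 1 0 (-183) (-1017)
      [(2, 6, 6), (3, 1, 5), (5, 2, 2)]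
      (by intro t ht; simp only [List.mem_cons, List.not_mem_nil, or_false] at ht; rcases ht with rfl | rfl | rfl <;> norm_num)
      (by decide +kernel) (by decide +kernel))
    hr (by norm_num) hN (by norm_num)

/-- ROW `(2450ba, 7)`: RESIDUE open cell `X4` — `2450ba1` `[1,-1,1,-2680,-50053]` (curve 1), `N = 2450 = 2·5^2·7^2 <
5000`, additive at `7`, `E[7]` irreducible (class word X4), `r = 1`, `#tors = 1`, `∏c = 21`, `#Ш_an = 1`. NO
certificate line: `BSD(E,7)` is the UMBRELLA print (Miller 2011 Thm. 1.2 with Creutz–Miller 2012: every `E/ℚ` with `N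
< 5000`, `r_an ≤ 1`, every prime) via the tree's named facts `hirr`/`hred`; displayed: `hr` (Cremona rank), `hN`
(conductor, Cremona); kernel-decided: `Δ ≠ 0` and global minimality (Kraus support `|Δ| = 2^7·5^8·7^4`).
[cite: Miller2011LMS, Thm. 1.2 and §7] [cite: CreutzMiller2012, Thm. 1.1] [cite: Cremona1997, Table 1 (Cremona label 2450ba1)] -/
theorem bsdp7_n5k_2450ba1 (hirr : bsdp_of_irreducible_of_conductor_lt)
    (hred : bsdp_of_reducible_of_conductor_lt)
    (W : WeierstrassCurve ℚ) (hWm : W = ⟨1, -1, 1, -2680, -50053⟩) (hr : W.analyticRank = 1)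
    (hN : W.conductorNorm ℤ = 2450) : BSDp W 7 := by
  subst hWm
  exact bsdp_of_ainvs_of_conductor_lt hirr hred 1 (-1) 1 (-2680) (-50053) 7 (by norm_num) (by decide +kernel)
    (isGloballyMinimal_of_krausCriterion_support 1 (-1) 1 (-2680) (-50053)
      [(2, 1, 7), (5, 2, 8), (7, 2, 4)]
      (by intro t ht; simp only [List.mem_cons, List.not_mem_nil, or_false] at ht; rcases ht with rfl | rfl | rfl <;> norm_num)
      (by decide +kernel) (by decide +kernel))
    hr (by norm_num) hN (by norm_num)

/-- ROW `(2450bd, 7)`: RESIDUE open cell `X4` — `2450bd1` `[1,-1,1,-131305,17430697]` (curve 1), `N = 2450 = 2·5^2·7^2 <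
5000`, additive at `7`, `E[7]` irreducible (class word X4), `r = 0`, `#tors = 1`, `∏c = 7`, `#Ш_an = 1`. NO
certificate line: `BSD(E,7)` is the UMBRELLA print (Miller 2011 Thm. 1.2 with Creutz–Miller 2012: every `E/ℚ` with `N
< 5000`, `r_an ≤ 1`, every prime) via the tree's named facts `hirr`/`hred`; displayed: `hr` (Cremona rank), `hN`
(conductor, Cremona); kernel-decided: `Δ ≠ 0` and global minimality (Kraus support `|Δ| = 2^7·5^8·7^10`).
[cite: Miller2011LMS, Thm. 1.2 and §7] [cite: CreutzMiller2012, Thm. 1.1] [cite: Cremona1997, Table 1 (Cremona label 2450bd1)] -/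
theorem bsdp7_n5k_2450bd1 (hirr : bsdp_of_irreducible_of_conductor_lt)
    (hred : bsdp_of_reducible_of_conductor_lt)
    (W : WeierstrassCurve ℚ) (hWm : W = ⟨1, -1, 1, -131305, 17430697⟩) (hr : W.analyticRank = 0)
    (hN : W.conductorNorm ℤ = 2450) : BSDp W 7 := by
  subst hWm
  exact bsdp_of_ainvs_of_conductor_lt hirr hred 1 (-1) 1 (-131305) 17430697 7 (by norm_num) (by decide +kernel)
    (isGloballyMinimal_of_krausCriterion_support 1 (-1) 1 (-131305) 17430697
      [(2, 1, 7), (5, 2, 8), (7, 2, 10)]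
      (by intro t ht; simp only [List.mem_cons, List.not_mem_nil, or_false] at ht; rcases ht with rfl | rfl | rfl <;> norm_num)
      (by decide +kernel) (by decide +kernel))
    hr (by norm_num) hN (by norm_num)

end Summit.BirchSwinnertonDyer.Rank1Residual.LW16

end
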